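import Summits.AnomalousDissipation.AnomalousDissipation.Theorems.CoherentFractionBoundedQuietPlanarity.Negative.SteadyLerayHopfPower
import Literature.Analysis.FluidPDE.LerayHopfGalileanTorusTools
import HarnessLib

/-!
# Windy inviscid roots are invisible to viscous climates too
# (negative lane of `CoherentFraction.BoundedQuietPlanarity`, stmt-AnomalousDissipation-33307 — addendum)

`SteadyLerayHopfPower` treats a crossed-shear root as the MEAN-ZERO steady trajectory `t ↦ v_t`.  Its
natural lab-frame embedding is the WINDY steady field `U_t = m_t + v_t` (`m_t = t c_K e₁`), a genuine
classical steady Euler solution `(U·∇)U + ∇p = f_K` with mean velocity `m_t ≠ 0` — and the torus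
Leray–Hopf class of the viscous items (`Torus.IsGlobalLerayHopf`, force `f_K` mean zero) does admit
trajectories with non-zero (conserved) mean.  The power argument is blind to the wind: a steady
Leray–Hopf state `U = m + W` (`W` smooth, mean zero) pays `ν‖∇U‖₂² = ν‖∇W‖₂² ≤ (f, m + W) = (f, W)`
(`(f, m) = 0` as `f` has zero mean; the wind carries no enstrophy,
`Torus.eGradNormSq_comp_add_right_sub_const`, `FluidPDE.Torus`), and `(f, W) = 0` for an Euler root with drift `m`
(`integral_inner_eq_zero_of_eulerDriftRoot`).  Hence `W = 0` by Poincaré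
(`eq_zero_of_eGradNormSq_eq_zero`): NO windy inviscid root `m + W`, `W ≠ 0`, is a Leray–Hopf steady
state of `NS_ν(f)` at any `ν > 0` (`windyEulerRoot_not_isGlobalLerayHopf`); in particular none of the
lab-frame crossed-shear states `t c_K e₁ + v_t`, `t ≠ 0` (`windy_vfieldT_not_isGlobalLerayHopf`).
[folklore; Doering–Foias 2002 §2 for the power bound]
-/

noncomputable section

-- `Summit.<Summit>.<Problem>` is the tree's mandated summit-side namespace (CONVENTIONS §2); for this
-- single-conjunct summit the two segments coincide, so the duplicate is deliberate.
set_option linter.dupNamespace false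

namespace Summit.AnomalousDissipation.AnomalousDissipation.Theorems.CrossedShearRoot

open Real MeasureTheory Filter
open scoped InnerProductSpace ENNReal
open Literature.Analysis.FunctionSpaces Literature.Analysis.FunctionSpaces.Torus Literature.Analysis.FluidPDE

/-- **Poincaré on `H`, smooth form**: a smooth mean-zero divergence-free field with `‖∇W‖₂² = 0`
vanishes identically (`Torus.enorm_sq_le_eGradNormSq` on the state of `H` represented by `W`, then
continuity). [folklore] -/
theorem eq_zero_of_eGradNormSq_eq_zero {W : UnitAddTorus (Fin 3) → EuclideanSpace ℝ (Fin 3)} (hWs : IsSmooth W)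
    (hdiv : IsDivFree W) (hzm : HasZeroMean W) (h0 : eGradNormSq W = 0) : W = 0 := by
  have hmem : (hWs.memLp 2).toLp W ∈ Torus.smoothSolenoidal (Fin 3) :=
    ⟨W, hWs, hdiv, hzm, MemLp.coeFn_toLp (hWs.memLp 2)⟩
  set V : energySpace (Fin 3) := ⟨(hWs.memLp 2).toLp W, Torus.smoothSolenoidal_subset_energySpace hmem⟩ with hVdef
  have hV : rep V =ᵐ[volume] W := MemLp.coeFn_toLp (hWs.memLp 2)
  have hPoinc := Literature.Analysis.FluidPDE.Torus.enorm_sq_le_eGradNormSq V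
  have hcongr : eGradNormSq (rep V) = eGradNormSq W := eGradNormSq_congr_ae hV
  rw [hcongr, h0, nonpos_iff_eq_zero, pow_eq_zero_iff two_ne_zero] at hPoinc
  have hn : ‖V‖ₑ = ‖(V : Lp (EuclideanSpace ℝ (Fin 3)) 2 (volume : Measure (UnitAddTorus (Fin 3))))‖ₑ := rfl
  rw [hn] at hPoinc
  have hL : (V : Lp (EuclideanSpace ℝ (Fin 3)) 2 (volume : Measure (UnitAddTorus (Fin 3)))) = 0 :=
    enorm_eq_zero.1 hPoinc
  have hz : rep V =ᵐ[volume] 0 := by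
    show ((V : Lp (EuclideanSpace ℝ (Fin 3)) 2 (volume : Measure (UnitAddTorus (Fin 3)))) :
      UnitAddTorus (Fin 3) → EuclideanSpace ℝ (Fin 3)) =ᵐ[volume] 0
    rw [hL]
    exact Lp.coeFn_zero _ _ _
  exact (hWs.continuous.ae_eq_iff_eq volume continuous_const).1 (hV.symm.trans hz)

/-- A mean-zero force does no work on the wind: `(f, m) = 0`. [folklore] -/
theorem integral_inner_const_eq_zero {f : UnitAddTorus (Fin 3) → EuclideanSpace ℝ (Fin 3)}
    (hf : Integrable f volume) (hf0 : HasZeroMean f) (m : EuclideanSpace ℝ (Fin 3)) :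
    ∫ x, ⟪f x, m⟫_ℝ = 0 := by
  have h : ∫ x, ⟪f x, m⟫_ℝ = ∫ x, ⟪m, f x⟫_ℝ := integral_congr_ae (ae_of_all _ fun x => real_inner_comm _ _)
  have h0 : ∫ x, f x = 0 := hf0
  rw [h, integral_inner hf m, h0, inner_zero_right]

/-- **The wind carries no enstrophy**: `‖∇(m + W)‖₂² = ‖∇W‖₂²` for integrable `W`. [folklore] -/
theorem eGradNormSq_wind (m : EuclideanSpace ℝ (Fin 3)) {W : UnitAddTorus (Fin 3) → EuclideanSpace ℝ (Fin 3)}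
    (hW : Integrable W volume) : eGradNormSq (fun x => m + W x) = eGradNormSq W := by
  have hfun : (fun x => m + W x) = fun y => W (y + 0) - (-m) := by
    funext y; rw [add_zero, sub_neg_eq_add, add_comm]
  rw [hfun]
  exact Literature.Analysis.FluidPDE.Torus.eGradNormSq_comp_add_right_sub_const hW 0 (-m)

/-- **WINDY INVISCID ROOTS ARE INVISIBLE TO VISCOUS CLIMATES.** Let `W ≠ 0` be a smooth mean-zero
divergence-free classical root of the steady Euler equation with drift `m`,
`(W·∇)W + DW·m + ∇q = f` (`f` smooth, mean zero) — equivalently `U = m + W` is a classical steady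
Euler solution `(U·∇)U + ∇q = f` with mean velocity `m`.  Then the windy steady trajectory `t ↦ m + W`
is a global Leray–Hopf solution of `NS_ν(f)` for NO `ν > 0` and no datum:
`ν‖∇W‖₂² = ν‖∇U‖₂² ≤ (f, U) = (f, m) + (f, W) = 0` would force `W = 0`. [folklore] -/
theorem windyEulerRoot_not_isGlobalLerayHopf {f W : UnitAddTorus (Fin 3) → EuclideanSpace ℝ (Fin 3)}
    {q : UnitAddTorus (Fin 3) → ℝ} {m : EuclideanSpace ℝ (Fin 3)} (hfs : IsSmooth f) (hf0 : HasZeroMean f)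
    (hWs : IsSmooth W) (hdiv : IsDivFree W) (hzm : HasZeroMean W) (hq : IsSmooth q)
    (hroot : ∀ x, Torus.convect W W x + Torus.fderiv W x m + Torus.gradient q x = f x) (hW0 : W ≠ 0)
    {ν : ℝ} (hν : 0 < ν) (u₀ : UnitAddTorus (Fin 3) → EuclideanSpace ℝ (Fin 3)) :
    ¬ Torus.IsGlobalLerayHopf ν (fun _ => f) u₀ (fun _ => fun x => m + W x) := by
  intro hLH
  have h1 := steady_dissipation_le_power hν (hfs.memLp 2) hf0 hLH
  have hfin := eGradNormSq_lt_top_of_steady hLH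
  rw [eGradNormSq_wind m hWs.integrable] at h1 hfin
  have hP : ∫ x, ⟪f x, m + W x⟫_ℝ = 0 := by
    have i1 : Integrable (fun x => ⟪f x, m⟫_ℝ) volume := hfs.integrable.inner_const m
    have i2 : Integrable (fun x => ⟪f x, W x⟫_ℝ) volume := (hfs.inner hWs).integrable
    have hsplit : ∫ x, ⟪f x, m + W x⟫_ℝ = (∫ x, ⟪f x, m⟫_ℝ) + ∫ x, ⟪f x, W x⟫_ℝ := by
      rw [← integral_add i1 i2]
      exact integral_congr_ae (ae_of_all _ fun x => inner_add_right _ _ _)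
    rw [hsplit, integral_inner_const_eq_zero hfs.integrable hf0 m,
      integral_inner_eq_zero_of_eulerDriftRoot hWs hdiv hq m hroot, add_zero]
  have h2 : (eGradNormSq W).toReal = 0 := by
    have h0 : 0 ≤ (eGradNormSq W).toReal := ENNReal.toReal_nonneg
    nlinarith
  rcases (ENNReal.toReal_eq_zero_iff _).1 h2 with h | h
  · exact hW0 (eq_zero_of_eGradNormSq_eq_zero hWs hdiv hzm h)
  · exact absurd h hfin.ne

variable {t : ℝ}

/-- **No lab-frame crossed-shear state is a viscous steady state.** For every `t ≠ 0`, `ν > 0` and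
datum `u₀`, the windy steady field `U_t = t c_K e₁ + v_t` — a classical steady Euler solution of
`(U·∇)U + ∇p = f_K` with cross-flow `t c_K e₁` (`crossedShear_momentumT`) — is NOT a global Leray–Hopf
solution of `NS_ν(f_K)`. [folklore] -/
theorem windy_vfieldT_not_isGlobalLerayHopf (ht : t ≠ 0) {ν : ℝ} (hν : 0 < ν)
    (u₀ : UnitAddTorus (Fin 3) → EuclideanSpace ℝ (Fin 3)) :
    ¬ Torus.IsGlobalLerayHopf ν (fun _ => fK) u₀ (fun _ => fun x => driftT t + vfieldT t x) :=
  windyEulerRoot_not_isGlobalLerayHopf isSmooth_fK hasZeroMean_fK (isSmooth_vfieldT t) (isDivFree_vfieldT t)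
    (hasZeroMean_vfieldT t) isSmooth_pres (crossedShear_momentumT ht) (vfieldT_ne_zero ht) hν u₀

/-- The same with the force spelled as in the route items 33307 / 27440 / 33798. [folklore] -/
theorem windy_vfieldT_not_isGlobalLerayHopf_stokesMode (ht : t ≠ 0) {ν : ℝ} (hν : 0 < ν)
    (u₀ : UnitAddTorus (Fin 3) → EuclideanSpace ℝ (Fin 3)) :
    ¬ Torus.IsGlobalLerayHopf ν
      (fun _ => ⇑(Literature.Analysis.FluidPDE.Torus.stokesMode (![0, 2, 0] : Fin 3 → ℤ)
        (EuclideanSpace.single (0 : Fin 3) (1 : ℝ)) false)) u₀ (fun _ => fun x => driftT t + vfieldT t x) :=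
  windy_vfieldT_not_isGlobalLerayHopf ht hν u₀

end Summit.AnomalousDissipation.AnomalousDissipation.Theorems.CrossedShearRoot

end
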